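import Summits.RiemannHypothesis.RiemannHypothesis.Theses.SpectralTrace
import Summits.RiemannHypothesis.RiemannHypothesis.Theorems.WindowStep.Negative.FiniteMoves
import HarnessLib

/-!
# `WindowStep` — negative lemma toolkit: exponential-sum uniqueness from window tests (two index types)

Refuter (crux disprover) record for the crux `stmt-RiemannHypothesis-14659`
(`Summit.RiemannHypothesis.RiemannHypothesis.Theses.SpectralTrace.WindowStep`). The two-index
form of `FiniteMoves.multiset_eq_of_sum_weilMellin_eq`, used by `BothWays.lean`:

* `multiset_eq_of_sum_weilMellin_eq₂`: if `Σ_{k∈F} ĝ(1/2 + i a_k) = Σ_{k∈F'} ĝ(1/2 + i b_k)` for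
  every Weil test `g` supported in `[-A, A]` (`A > 0`), with `F, F'` finite sets of possibly
  different index types, then the multisets `{a_k}` and `{b_k}` are equal. Proof as in
  `FiniteMoves.lean`: the exponential polynomial `Σ e^{i a_k t} − Σ e^{i b_k t}` vanishes against
  all smooth `g` supported in `(−A, A)` (`IsOpen.ae_eq_zero_of_integral_contDiff_smul_eq_zero`),
  hence on `(−A, A)`, hence on `ℝ` (analytic continuation), hence coefficient-wise (Dedekind's
  independence of characters, `linearIndependent_monoidHom`).
-/

set_option linter.dupNamespace false

noncomputable section

open Complex Set Filter MeasureTheory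
open scoped Real Topology ContDiff

namespace Summit.RiemannHypothesis.RiemannHypothesis.Theorems.WindowStep.Negative

open Literature.NumberTheory.LFunctions
open Summit.RiemannHypothesis.RiemannHypothesis.Theses.SpectralTrace

/-! ### Exponential-sum uniqueness, two index types -/

/-- **Exponential-sum uniqueness from window tests (two index types).** If
`Σ_{k∈F} ĝ(1/2 + i a_k) = Σ_{k∈F'} ĝ(1/2 + i b_k)` for every Weil test `g` supported in
`[-A, A]` (`A > 0`), the two finite multisets are equal. [folklore] -/
theorem multiset_eq_of_sum_weilMellin_eq₂ {A : ℝ} (hA : 0 < A) {κ κ' : Type*} (F : Finset κ)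
    (F' : Finset κ') (a : κ → ℝ) (b : κ' → ℝ)
    (h : ∀ g : ℝ → ℂ, IsWeilTest g → tsupport g ⊆ Icc (-A) A →
      ∑ k ∈ F, weilMellin g (1 / 2 + (a k : ℂ) * I) =
        ∑ k ∈ F', weilMellin g (1 / 2 + (b k : ℂ) * I)) :
    F.val.map a = F'.val.map b := by
  classical
  set P : ℝ → ℂ := fun t =>
    ∑ k ∈ F, cexp ((a k : ℂ) * I * (t : ℂ)) - ∑ k ∈ F', cexp ((b k : ℂ) * I * (t : ℂ)) with hP
  have hPc : Continuous P := by
    simp only [hP]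
    fun_prop
  have hPa : AnalyticOnNhd ℝ P univ := by
    simp only [hP]
    refine AnalyticOnNhd.sub ?_ ?_ <;>
      exact Finset.analyticOnNhd_fun_sum _ fun k _ => analyticOnNhd_cexp_mul_I _
  set U : Set ℝ := Ioo (-A) A with hU
  have hUo : IsOpen U := isOpen_Ioo
  have h0U : (0 : ℝ) ∈ U := ⟨by linarith, hA⟩
  have hint : ∀ g : ℝ → ℝ, ContDiff ℝ ∞ g → HasCompactSupport g → tsupport g ⊆ U →
      ∫ t, g t • P t = 0 := by
    intro g hg hgc hgs
    set gc : ℝ → ℂ := fun t => ((g t : ℝ) : ℂ) with hgc_def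
    have hgcW : IsWeilTest gc :=
      ⟨Complex.ofRealCLM.contDiff.comp hg, hgc.comp_left Complex.ofReal_zero⟩
    have hgcs : tsupport gc ⊆ Icc (-A) A :=
      ((tsupport_comp_subset Complex.ofReal_zero _).trans hgs).trans Ioo_subset_Icc_self
    have h1 := h gc hgcW hgcs
    rw [sum_weilMellin_half_eq_integral hgcW, sum_weilMellin_half_eq_integral hgcW] at h1
    have hia : Integrable fun t : ℝ => gc t * ∑ k ∈ F, cexp ((a k : ℂ) * I * (t : ℂ)) :=
      (hgcW.1.continuous.mul (by fun_prop)).integrable_of_hasCompactSupport hgcW.2.mul_right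
    have hib : Integrable fun t : ℝ => gc t * ∑ k ∈ F', cexp ((b k : ℂ) * I * (t : ℂ)) :=
      (hgcW.1.continuous.mul (by fun_prop)).integrable_of_hasCompactSupport hgcW.2.mul_right
    calc ∫ t, g t • P t = ∫ t, (gc t * ∑ k ∈ F, cexp ((a k : ℂ) * I * (t : ℂ)) -
          gc t * ∑ k ∈ F', cexp ((b k : ℂ) * I * (t : ℂ))) := by
          refine integral_congr_ae (Eventually.of_forall fun t => ?_)
          simp only [hP, hgc_def, Complex.real_smul, mul_sub]
      _ = 0 := by rw [integral_sub hia hib, h1, sub_self]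
  have hae : ∀ᵐ t ∂volume, t ∈ U → P t = 0 :=
    hUo.ae_eq_zero_of_integral_contDiff_smul_eq_zero
      (hPc.locallyIntegrable.locallyIntegrableOn U) hint
  have hPU : ∀ t ∈ U, P t = 0 := by
    by_contra hne
    push Not at hne
    obtain ⟨t₀, ht₀U, ht₀⟩ := hne
    set V : Set ℝ := U ∩ {t | P t ≠ 0} with hV
    have hVo : IsOpen V := hUo.inter (isOpen_ne_fun hPc continuous_const)
    have hVpos : 0 < volume V := hVo.measure_pos volume ⟨t₀, ht₀U, ht₀⟩
    have hVnull : volume V = 0 := by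
      rw [ae_iff] at hae
      refine measure_mono_null (fun t ht => ?_) hae
      simp only [mem_setOf_eq, Classical.not_imp]
      exact ⟨ht.1, ht.2⟩
    exact hVpos.ne' hVnull
  have hP0 : ∀ t : ℝ, P t = 0 := by
    have hev : P =ᶠ[𝓝 (0 : ℝ)] 0 := eventuallyEq_of_mem (hUo.mem_nhds h0U) fun t ht => hPU t ht
    have hEq := hPa.eqOn_zero_of_preconnected_of_eventuallyEq_zero isPreconnected_univ
      (mem_univ 0) hev
    exact fun t => hEq (mem_univ t)
  set Λ : Finset ℝ := F.image a ∪ F'.image b with hΛ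
  have haΛ : ∀ k ∈ F, a k ∈ Λ := fun k hk =>
    Finset.mem_union_left _ (Finset.mem_image_of_mem a hk)
  have hbΛ : ∀ k ∈ F', b k ∈ Λ := fun k hk =>
    Finset.mem_union_right _ (Finset.mem_image_of_mem b hk)
  set cA : ℝ → ℕ := fun x => (F.filter fun k => a k = x).card with hcA
  set cB : ℝ → ℕ := fun x => (F'.filter fun k => b k = x).card with hcB
  have hregA : ∀ t : ℝ, ∑ k ∈ F, cexp ((a k : ℂ) * I * (t : ℂ)) =
      ∑ x ∈ Λ, (cA x : ℂ) * cexp ((x : ℂ) * I * (t : ℂ)) := by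
    intro t
    rw [← Finset.sum_fiberwise_of_maps_to' haΛ (fun x : ℝ => cexp ((x : ℂ) * I * (t : ℂ)))]
    refine Finset.sum_congr rfl fun x _ => ?_
    rw [Finset.sum_const, nsmul_eq_mul]
  have hregB : ∀ t : ℝ, ∑ k ∈ F', cexp ((b k : ℂ) * I * (t : ℂ)) =
      ∑ x ∈ Λ, (cB x : ℂ) * cexp ((x : ℂ) * I * (t : ℂ)) := by
    intro t
    rw [← Finset.sum_fiberwise_of_maps_to' hbΛ (fun x : ℝ => cexp ((x : ℂ) * I * (t : ℂ)))]
    refine Finset.sum_congr rfl fun x _ => ?_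
    rw [Finset.sum_const, nsmul_eq_mul]
  let χ : ℝ → (Multiplicative ℝ →* ℂ) := fun x =>
    { toFun := fun u => cexp ((x : ℂ) * I * ((Multiplicative.toAdd u : ℝ) : ℂ))
      map_one' := by simp
      map_mul' := fun u v => by
        rw [← Complex.exp_add]
        congr 1
        simp only [toAdd_mul, Complex.ofReal_add]
        ring }
  have hχ : Function.Injective χ := by
    intro x y hxy
    refine eq_of_cexp_mul_I_eq fun t => ?_
    have := DFunLike.congr_fun hxy (Multiplicative.ofAdd t)
    simpa [χ] using this
  have hLI := (linearIndependent_monoidHom (Multiplicative ℝ) ℂ).comp χ hχ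
  have hcoef : ∀ x ∈ Λ, ((cA x : ℂ) - (cB x : ℂ)) = 0 := by
    refine linearIndependent_iff'.1 hLI Λ (fun x => (cA x : ℂ) - (cB x : ℂ)) ?_
    funext u
    simp only [Finset.sum_apply, Pi.smul_apply, Function.comp_apply, smul_eq_mul,
      Pi.zero_apply]
    have h1 := hP0 (Multiplicative.toAdd u)
    simp only [hP, hregA, hregB, ← Finset.sum_sub_distrib] at h1
    rw [← h1]
    refine Finset.sum_congr rfl fun x _ => ?_
    simp only [χ, MonoidHom.coe_mk, OneHom.coe_mk]
    ring
  have hcount : ∀ x : ℝ, cA x = cB x := by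
    intro x
    by_cases hx : x ∈ Λ
    · have := hcoef x hx
      rw [sub_eq_zero] at this
      exact_mod_cast this
    · have hA0 : cA x = 0 := by
        simp only [hcA, Finset.card_eq_zero, Finset.filter_eq_empty_iff]
        intro k hk hkx
        exact hx (hkx ▸ haΛ k hk)
      have hB0 : cB x = 0 := by
        simp only [hcB, Finset.card_eq_zero, Finset.filter_eq_empty_iff]
        intro k hk hkx
        exact hx (hkx ▸ hbΛ k hk)
      rw [hA0, hB0]
  ext x
  rw [Multiset.count_map, Multiset.count_map]
  have e1 : (Multiset.filter (fun k => x = a k) F.val).card = cA x := by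
    simp only [hcA, Finset.card_def, Finset.filter_val]
    congr 1
    exact Multiset.filter_congr fun k _ => eq_comm
  have e2 : (Multiset.filter (fun k => x = b k) F'.val).card = cB x := by
    simp only [hcB, Finset.card_def, Finset.filter_val]
    congr 1
    exact Multiset.filter_congr fun k _ => eq_comm
  rw [e1, e2, hcount]

end Summit.RiemannHypothesis.RiemannHypothesis.Theorems.WindowStep.Negative

end
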